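import Summits.CriticalPhenomena.PercolationContinuityZ3.Theorems.PercNearOneGluingAdditiveGluingBlockGoodTwoRelays
import HarnessLib

/-! # Crux `PercNearOneGluing.AdditiveGluing` (stmt-CriticalPhenomena-4576), line `peel` — the DEAD-POCKET DRIFT toward a relay is paid
# by that relay's K-cone (peel cell, strategy (d) "generalise the certificates", part 3)

Support file (`--supports stmt-CriticalPhenomena-4576`); no definitions, no named facts.

`μ = prodBernoulli u` on the bond configurations of `Fin n`; relays `A ∋ b, a₀, a` with `μ(a₀ ↔ b) ≤ μ(a ↔ b)` (an instance of `hmin`);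
a block `S ≠ ∅` with cluster `K_S = ⋃_{s∈S} C(s)`, fibres `{K_S = W}`, dead pockets `W ∩ A = ∅`.  In the leaf expansion of the block kernel
(`…KernelCornerForm.lean`: `Slack = Λ − Δ`) the dead-pocket term compares `a₀` with the locally worst relay INSIDE each dead pocket's
complement; the exact certificates of the n = 6 class showed that this drift deficit is always dominated by the K-cone surplus of the same
relay (0/343 drift instances, ratio ≤ 0.17).  This file proves the general-n inequality behind that observation:

* `deadDrift_le_kCone`:
  `Σ_{W∩A=∅} μ(K_S=W)·μ(a₀ ↔ b off W) − Σ_{W∩A=∅} μ(K_S=W)·μ(a ↔ b off W) ≤ μ(a↔b, a ∈ K_S, a₀ ∉ K_S) − μ(a₀↔b, a ∈ K_S, a₀ ∉ K_S)`,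
  i.e. the (signed) dead-pocket drift of `a₀` over `a` is at most the K-cone comparison of `a` against `a₀`.
  Proof: Kozma–Nitzan's Lemma 3 for the SANDWICH family `𝓕 = {T | a ∈ T, a₀ ∉ T} ∪ {dead pockets}` of the block's cluster
  (`lemma3_sandwich_set`, seat sp), the fibre partition `real_inter_blockSandwichFamily`, and pocket Markov `blockPocket_mul_offConn`.
  With `a` the local minimiser of a single dead pocket this is "Δ ≤ Kcone(a)"; it is the drift-paying half of every linear certificate found
  by the peel cell's LPs (the other half — sharing the cone surplus with the remaining bad corners — is the open, u-weighted step).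
[cite: KozmaNitzan2024, Lemma 3 (pp. 6–7), §3.2 pp. 12–14] [cite: VandenbergHaggstromKahn2005, Thms. 1.3–1.5]
-/

namespace Summit.CriticalPhenomena.PercolationContinuityZ3.Theorems

open MeasureTheory Set
open Literature.Probability.LatticeModels (prodBernoulli)
open Literature.Probability.Percolation (BondConfig openConn openConnIn openGraph openCluster)
open scoped BigOperators Classical

noncomputable section

section DeadDriftCone

open Literature.Probability.LatticeModels Literature.Probability.Percolation

variable {n : ℕ}

/-- **The dead-pocket drift toward `a` is paid by the K-cone of `a`.**  For `S ≠ ∅`, relays `A ∋ a₀, a` and `μ(a₀ ↔ b) ≤ μ(a ↔ b)`: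
`Σ_{W∩A=∅} μ(K_S=W)·μ(a₀ ↔ b off W) − Σ_{W∩A=∅} μ(K_S=W)·μ(a ↔ b off W) ≤ μ(a↔b ∩ {S↔a} ∩ {S↮a₀}) − μ(a₀↔b ∩ {S↔a} ∩ {S↮a₀})`.
[cite: KozmaNitzan2024, Lemma 3 (pp. 6–7), §3.2 pp. 12–14] [cite: VandenbergHaggstromKahn2005, Thms. 1.3–1.5] -/
theorem deadDrift_le_kCone (u : Sym2 (Fin n) → unitInterval) (A S : Finset (Fin n)) (b a₀ a : Fin n) (hS : S.Nonempty)
    (ha₀A : a₀ ∈ A) (haA : a ∈ A)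
    (hle : (prodBernoulli u).real (openConn a₀ b) ≤ (prodBernoulli u).real (openConn a b)) :
    (∑ W ∈ (Finset.univ : Finset (Finset (Fin n))).filter (fun W => Disjoint W A),
        (prodBernoulli u).real {ω : BondConfig (Fin n) | ∀ z : Fin n, (z ∈ W ↔ ω ∈ ⋃ s ∈ S, openConn s z)}
          * (prodBernoulli u).real (openConnIn ((W : Set (Fin n))ᶜ) a₀ b))
      - (∑ W ∈ (Finset.univ : Finset (Finset (Fin n))).filter (fun W => Disjoint W A),
        (prodBernoulli u).real {ω : BondConfig (Fin n) | ∀ z : Fin n, (z ∈ W ↔ ω ∈ ⋃ s ∈ S, openConn s z)}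
          * (prodBernoulli u).real (openConnIn ((W : Set (Fin n))ᶜ) a b))
    ≤ (prodBernoulli u).real (openConn a b ∩ ((⋃ s ∈ S, openConn s a) ∩ (⋃ s ∈ S, openConn s a₀)ᶜ))
      - (prodBernoulli u).real (openConn a₀ b ∩ ((⋃ s ∈ S, openConn s a) ∩ (⋃ s ∈ S, openConn s a₀)ᶜ)) := by
  set μ := prodBernoulli u with hμ
  set 𝒟 : Finset (Finset (Fin n)) := (Finset.univ : Finset (Finset (Fin n))).filter (fun W => Disjoint W A) with h𝒟
  set KW : Finset (Fin n) → Set (BondConfig (Fin n)) :=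
    fun W => {ω : BondConfig (Fin n) | ∀ z : Fin n, (z ∈ W ↔ ω ∈ ⋃ s ∈ S, openConn s z)} with hKW
  have hmem𝒟 : ∀ W, W ∈ 𝒟 ↔ Disjoint W A := fun W => by simp [h𝒟]
  have hnotin : ∀ W ∈ 𝒟, ∀ a' ∈ A, a' ∉ W := fun W hW a' ha' h =>
    Finset.disjoint_left.1 ((hmem𝒟 W).1 hW) h ha'
  -- pocket Markov: the two sums are fibre sums of `{K_S = W} ∩ {a' ↔ b}`
  have hsum : ∀ a' ∈ A, ∑ W ∈ 𝒟, μ.real (KW W) * μ.real (openConnIn ((W : Set (Fin n))ᶜ) a' b) =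
      ∑ W ∈ 𝒟, μ.real (KW W ∩ openConn a' b) := fun a' ha' =>
    Finset.sum_congr rfl fun W hW => blockPocket_mul_offConn u S W hS a' b (hnotin W hW a' ha')
  rw [hsum a₀ ha₀A, hsum a haA]
  -- the sandwich family `𝓕 = {a ∈ T ∌ a₀} ∪ {dead pockets}` and its fibre partition
  set 𝓕 : Set (Set (Fin n)) := {T : Set (Fin n) | a ∈ T ∧ a₀ ∉ T} ∪ {T | ∃ W ∈ 𝒟, T = (W : Set (Fin n))} with h𝓕
  have hpart : ∀ E : Set (BondConfig (Fin n)),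
      μ.real (E ∩ {ω | (⋃ s ∈ S, openCluster ω s) ∈ 𝓕}) =
        μ.real (E ∩ ((⋃ s ∈ S, openConn s a) ∩ (⋃ s ∈ S, openConn s a₀)ᶜ)) + ∑ W ∈ 𝒟, μ.real (KW W ∩ E) :=
    fun E => real_inter_blockSandwichFamily u S a₀ a 𝒟 (fun W hW => hnotin W hW a haA) E
  -- Kozma–Nitzan Lemma 3 for the sandwich event
  have hlo : ∀ ω : BondConfig (Fin n), a ∈ (⋃ s ∈ S, openCluster ω s) → a₀ ∉ (⋃ s ∈ S, openCluster ω s) →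
      (⋃ s ∈ S, openCluster ω s) ∈ 𝓕 := fun ω h1 h2 => Or.inl ⟨h1, h2⟩
  have hhi : ∀ ω : BondConfig (Fin n), (⋃ s ∈ S, openCluster ω s) ∈ 𝓕 → a₀ ∉ (⋃ s ∈ S, openCluster ω s) := by
    rintro ω (⟨-, h2⟩ | ⟨W, hW, hWe⟩)
    · exact h2
    · rw [hWe]
      exact fun h => hnotin W hW a₀ ha₀A (Finset.mem_coe.1 h)
  have h3 := SandwichSet.lemma3_sandwich_set u a₀ a b S 𝓕 hlo hhi hle
  have e₀ := hpart (openConn a₀ b)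
  have e₁ := hpart (openConn a b)
  rw [e₀, e₁] at h3
  have c₀ : μ.real (openConn a₀ b ∩ ((⋃ s ∈ S, openConn s a) ∩ (⋃ s ∈ S, openConn s a₀)ᶜ)) =
      μ.real ((⋃ s ∈ S, openConn s a) ∩ (⋃ s ∈ S, openConn s a₀)ᶜ ∩ openConn a₀ b) := by
    rw [Set.inter_comm]
  have c₁ : μ.real (openConn a b ∩ ((⋃ s ∈ S, openConn s a) ∩ (⋃ s ∈ S, openConn s a₀)ᶜ)) =
      μ.real ((⋃ s ∈ S, openConn s a) ∩ (⋃ s ∈ S, openConn s a₀)ᶜ ∩ openConn a b) := by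
    rw [Set.inter_comm]
  linarith

/-- Registered stub `stub_deadDriftCone_pd` (peel cell (d)): `deadDrift_le_kCone`, ∀-closed.
[cite: KozmaNitzan2024, Lemma 3 (pp. 6–7)] [cite: VandenbergHaggstromKahn2005, Thms. 1.3–1.5] -/
theorem stub_deadDriftCone_pd : ∀ (n : ℕ) (u : Sym2 (Fin n) → unitInterval) (A S : Finset (Fin n)) (b a₀ a : Fin n), S.Nonempty → a₀ ∈ A → a ∈ A → (prodBernoulli u).real (openConn a₀ b) ≤ (prodBernoulli u).real (openConn a b) → (∑ W ∈ (Finset.univ : Finset (Finset (Fin n))).filter (fun W => Disjoint W A), (prodBernoulli u).real {ω : BondConfig (Fin n) | ∀ z : Fin n, (z ∈ W ↔ ω ∈ ⋃ s ∈ S, openConn s z)} * (prodBernoulli u).real (openConnIn ((W : Set (Fin n))ᶜ) a₀ b)) - (∑ W ∈ (Finset.univ : Finset (Finset (Fin n))).filter (fun W => Disjoint W A), (prodBernoulli u).real {ω : BondConfig (Fin n) | ∀ z : Fin n, (z ∈ W ↔ ω ∈ ⋃ s ∈ S, openConn s z)} * (prodBernoulli u).real (openConnIn ((W : Set (Fin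 n))ᶜ) a b)) ≤ (prodBernoulli u).real (openConn a b ∩ ((⋃ s ∈ S, openConn s a) ∩ (⋃ s ∈ S, openConn s a₀)ᶜ)) - (prodBernoulli u).real (openConn a₀ b ∩ ((⋃ s ∈ S, openConn s a) ∩ (⋃ s ∈ S, openConn s a₀)ᶜ)) :=
  fun _ u A S b a₀ a hS ha₀ ha hle => deadDrift_le_kCone u A S b a₀ a hS ha₀ ha hle

end DeadDriftCone

end

end Summit.CriticalPhenomena.PercolationContinuityZ3.Theorems
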